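import Mathlib
import Summits.Ventures.DiscreteObjects.Mahler.TraceLiftMeasure
import Summits.Ventures.DiscreteObjects.Mahler.CensusData10to18

/-!
# Kernel certificates for the degree-10 height-1 Salem cores `c10_02` / `c10_03` (venture `DiscreteObjects`, target L)

Cell `pub-namedobj`, seat `pub-namedobj-mahler` (gen 10). Framing: lottery ticket; floor = certified
bounds/negative ranges.

Third-engine (KERNEL) certification of census cores: of the seven degree-10 height-1 cores of the cell's census
(`CensusData10to18.coresDeg10`, measures in `(1, 1.3)` certified by two numeric engines), five are Salem
polynomials (all trace roots real, one of modulus `> 2`): `c10_01` = Lehmer's polynomial in `-x` (12-digit kernel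
enclosure, gen 2) and `c10_02, c10_03, c10_04, c10_07`, whose measures `1.21639166…, 1.23039143…, 1.26123096…,
1.29348595…` (Boyd's small Salem numbers of degree 10) are enclosed here to 8 decimals via
`salem_traceLift_certificate`; `c10_05, c10_06` have a complex pair of trace roots (outside this certificate).
-/

namespace Summit.Ventures.DiscreteObjects.Mahler

open Polynomial

/-- `traceLift` of the trace polynomial of `c10_02` is the core `c10_02`. -/
theorem traceLift_c10_02 : traceLift (X ^ 5 - C 5 * X ^ 3 + C 4 * X - 1 : ℤ[X]) = ofCoeffs c10_02 := by
  have hdeg : (X ^ 5 - C 5 * X ^ 3 + C 4 * X - 1 : ℤ[X]).natDegree = 5 := by compute_degree!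
  have hP : ofCoeffs c10_02 = (X ^ 10 - X ^ 6 - X ^ 5 - X ^ 4 + 1 : ℤ[X]) := by
    unfold ofCoeffs c10_02; simp [List.zipIdx]; ring
  rw [hP, traceLift, hdeg]
  simp only [Finset.sum_range_succ, Finset.sum_range_zero, zero_add, coeff_add, coeff_sub, coeff_X_pow,
    coeff_C_mul, coeff_X, coeff_one]
  norm_num
  ring

/-- **`1.21639166 < M(c10_02) < 1.21639167`** — a degree-10 Salem number (height-1 census core). -/
theorem c10_02_measure_enclosure :
    (121639166 / 10 ^ 8 : ℝ) < intMahlerMeasure (ofCoeffs c10_02) ∧ intMahlerMeasure (ofCoeffs c10_02) < 121639167 / 10 ^ 8 := by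
  set Q : ℤ[X] := X ^ 5 - C 5 * X ^ 3 + C 4 * X - 1 with hQdef
  have hQmonic : Q.Monic := by rw [hQdef]; monicity!
  have hQdeg : Q.natDegree = 5 := by rw [hQdef]; compute_degree!
  set f : ℝ → ℝ := fun y => y ^ 5 - 5 * y ^ 3 + 4 * y - 1 with hf
  have hcont : Continuous f := by rw [hf]; fun_prop
  have hfQ : ∀ y : ℝ, aeval (y : ℂ) Q = ((f y : ℝ) : ℂ) := by
    intro y
    rw [hQdef, hf]
    simp only [map_add, map_sub, map_mul, map_pow, aeval_X, map_ofNat, map_one]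
    push_cast; ring
  have root : ∀ a b : ℝ, a ≤ b → (f a < 0 ∧ 0 < f b) ∨ (f b < 0 ∧ 0 < f a) →
      ∃ y, a < y ∧ y < b ∧ f y = 0 := by
    intro a b hab h
    rcases h with ⟨ha, hb⟩ | ⟨hb, ha⟩
    · obtain ⟨y, hy, hfy⟩ := intermediate_value_Ioo hab hcont.continuousOn ⟨ha, hb⟩
      exact ⟨y, hy.1, hy.2, hfy⟩
    · obtain ⟨y, hy, hfy⟩ := intermediate_value_Ioo' hab hcont.continuousOn ⟨hb, ha⟩
      exact ⟨y, hy.1, hy.2, hfy⟩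
  set c₁ : ℝ := 121639166 / 10 ^ 8 with hc₁
  set c₂ : ℝ := 121639167 / 10 ^ 8 with hc₂
  obtain ⟨y1, h1a, h1b, h1f⟩ := root (c₁ + c₁⁻¹) (c₂ + c₂⁻¹) (by rw [hc₁, hc₂]; norm_num)
    (Or.inl ⟨by rw [hf, hc₁]; norm_num, by rw [hf, hc₂]; norm_num⟩)
  obtain ⟨y2, h2a, h2b, h2f⟩ := root ((-2) : ℝ) (((-3) : ℝ) / 2) (by norm_num)
    (Or.inl ⟨by rw [hf]; norm_num, by rw [hf]; norm_num⟩)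
  obtain ⟨y3, h3a, h3b, h3f⟩ := root (((-3) : ℝ) / 2) ((-1) : ℝ) (by norm_num)
    (Or.inr ⟨by rw [hf]; norm_num, by rw [hf]; norm_num⟩)
  obtain ⟨y4, h4a, h4b, h4f⟩ := root ((-1) : ℝ) ((1 : ℝ) / 2) (by norm_num)
    (Or.inl ⟨by rw [hf]; norm_num, by rw [hf]; norm_num⟩)
  obtain ⟨y5, h5a, h5b, h5f⟩ := root ((1 : ℝ) / 2) (2 : ℝ) (by norm_num)
    (Or.inr ⟨by rw [hf]; norm_num, by rw [hf]; norm_num⟩)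
  have hc1y : 2 < c₁ + c₁⁻¹ := by rw [hc₁]; norm_num
  have hy1 : 2 < y1 := lt_trans hc1y h1a
  set s : Multiset ℝ := {y1, y2, y3, y4, y5} with hs
  have h1_2 : y1 ≠ y2 := ne_of_gt (by linarith)
  have h1_3 : y1 ≠ y3 := ne_of_gt (by linarith)
  have h1_4 : y1 ≠ y4 := ne_of_gt (by linarith)
  have h1_5 : y1 ≠ y5 := ne_of_gt (by linarith)
  have h2_3 : y2 ≠ y3 := ne_of_lt (by linarith)
  have h2_4 : y2 ≠ y4 := ne_of_lt (by linarith)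
  have h2_5 : y2 ≠ y5 := ne_of_lt (by linarith)
  have h3_4 : y3 ≠ y4 := ne_of_lt (by linarith)
  have h3_5 : y3 ≠ y5 := ne_of_lt (by linarith)
  have h4_5 : y4 ≠ y5 := ne_of_lt (by linarith)
  have hnodup : s.Nodup := by
    rw [hs]; simp [Multiset.insert_eq_cons, h1_2, h1_3, h1_4, h1_5, h2_3, h2_4, h2_5, h3_4, h3_5, h4_5]
  have hcard : Multiset.card s = Q.natDegree := by rw [hQdeg, hs]; simp
  have hroot : ∀ y ∈ s, aeval (y : ℂ) Q = 0 := by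
    intro y hy
    rw [hfQ]
    rw [hs] at hy
    simp only [Multiset.insert_eq_cons, Multiset.mem_cons, Multiset.mem_singleton] at hy
    rcases hy with rfl | rfl | rfl | rfl | rfl
    · rw [h1f]; simp
    · rw [h2f]; simp
    · rw [h3f]; simp
    · rw [h4f]; simp
    · rw [h5f]; simp
  have hy₁ : y1 ∈ s := by rw [hs]; simp
  have hbig : 2 < |y1| := by rw [abs_of_pos (by linarith)]; linarith
  have hsmall : ∀ y ∈ s.erase y1, |y| ≤ 2 := by
    intro y hy
    have hy' : y ∈ s ∧ y ≠ y1 := ⟨Multiset.mem_of_mem_erase hy, ((Multiset.Nodup.mem_erase_iff hnodup).mp hy).1⟩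
    rw [hs] at hy'
    simp only [Multiset.insert_eq_cons, Multiset.mem_cons, Multiset.mem_singleton] at hy'
    obtain ⟨hy'', hne⟩ := hy'
    rcases hy'' with rfl | rfl | rfl | rfl | rfl
    · exact absurd rfl hne
    · rw [abs_le]; constructor <;> linarith
    · rw [abs_le]; constructor <;> linarith
    · rw [abs_le]; constructor <;> linarith
    · rw [abs_le]; constructor <;> linarith
  obtain ⟨-, hM1, hMM⟩ := salem_traceLift_certificate hQmonic s hnodup hcard hroot hy₁ hbig hsmall
  rw [traceLift_c10_02] at hM1 hMM
  rw [abs_of_pos (by linarith)] at hMM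
  have hMpos : 0 < intMahlerMeasure (ofCoeffs c10_02) := by linarith
  constructor
  · have h : c₁ + c₁⁻¹ < intMahlerMeasure (ofCoeffs c10_02) + (intMahlerMeasure (ofCoeffs c10_02))⁻¹ := by
      rw [hMM]; linarith
    exact lt_of_add_inv_lt_add_inv hM1.le (by rw [hc₁]; norm_num) h
  · have h : intMahlerMeasure (ofCoeffs c10_02) + (intMahlerMeasure (ofCoeffs c10_02))⁻¹ < c₂ + c₂⁻¹ := by
      rw [hMM]; linarith
    exact lt_of_add_inv_lt_add_inv (by rw [hc₂]; norm_num) hMpos h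

/-- `traceLift` of the trace polynomial of `c10_03` is the core `c10_03`. -/
theorem traceLift_c10_03 : traceLift (X ^ 5 - C 5 * X ^ 3 - X ^ 2 + C 5 * X + 1 : ℤ[X]) = ofCoeffs c10_03 := by
  have hdeg : (X ^ 5 - C 5 * X ^ 3 - X ^ 2 + C 5 * X + 1 : ℤ[X]).natDegree = 5 := by compute_degree!
  have hP : ofCoeffs c10_03 = (X ^ 10 - X ^ 7 - X ^ 5 - X ^ 3 + 1 : ℤ[X]) := by
    unfold ofCoeffs c10_03; simp [List.zipIdx]; ring
  rw [hP, traceLift, hdeg]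
  simp only [Finset.sum_range_succ, Finset.sum_range_zero, zero_add, coeff_add, coeff_sub, coeff_X_pow,
    coeff_C_mul, coeff_X, coeff_one]
  norm_num
  ring

/-- **`1.23039143 < M(c10_03) < 1.23039144`** — a degree-10 Salem number (height-1 census core). -/
theorem c10_03_measure_enclosure :
    (123039143 / 10 ^ 8 : ℝ) < intMahlerMeasure (ofCoeffs c10_03) ∧ intMahlerMeasure (ofCoeffs c10_03) < 123039144 / 10 ^ 8 := by
  set Q : ℤ[X] := X ^ 5 - C 5 * X ^ 3 - X ^ 2 + C 5 * X + 1 with hQdef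
  have hQmonic : Q.Monic := by rw [hQdef]; monicity!
  have hQdeg : Q.natDegree = 5 := by rw [hQdef]; compute_degree!
  set f : ℝ → ℝ := fun y => y ^ 5 - 5 * y ^ 3 - y ^ 2 + 5 * y + 1 with hf
  have hcont : Continuous f := by rw [hf]; fun_prop
  have hfQ : ∀ y : ℝ, aeval (y : ℂ) Q = ((f y : ℝ) : ℂ) := by
    intro y
    rw [hQdef, hf]
    simp only [map_add, map_sub, map_mul, map_pow, aeval_X, map_ofNat, map_one]
    push_cast; ring
  have root : ∀ a b : ℝ, a ≤ b → (f a < 0 ∧ 0 < f b) ∨ (f b < 0 ∧ 0 < f a) →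
      ∃ y, a < y ∧ y < b ∧ f y = 0 := by
    intro a b hab h
    rcases h with ⟨ha, hb⟩ | ⟨hb, ha⟩
    · obtain ⟨y, hy, hfy⟩ := intermediate_value_Ioo hab hcont.continuousOn ⟨ha, hb⟩
      exact ⟨y, hy.1, hy.2, hfy⟩
    · obtain ⟨y, hy, hfy⟩ := intermediate_value_Ioo' hab hcont.continuousOn ⟨hb, ha⟩
      exact ⟨y, hy.1, hy.2, hfy⟩
  set c₁ : ℝ := 123039143 / 10 ^ 8 with hc₁
  set c₂ : ℝ := 123039144 / 10 ^ 8 with hc₂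
  obtain ⟨y1, h1a, h1b, h1f⟩ := root (c₁ + c₁⁻¹) (c₂ + c₂⁻¹) (by rw [hc₁, hc₂]; norm_num)
    (Or.inl ⟨by rw [hf, hc₁]; norm_num, by rw [hf, hc₂]; norm_num⟩)
  obtain ⟨y2, h2a, h2b, h2f⟩ := root ((-2) : ℝ) (((-3) : ℝ) / 2) (by norm_num)
    (Or.inl ⟨by rw [hf]; norm_num, by rw [hf]; norm_num⟩)
  obtain ⟨y3, h3a, h3b, h3f⟩ := root (((-3) : ℝ) / 2) ((-1) : ℝ) (by norm_num)
    (Or.inr ⟨by rw [hf]; norm_num, by rw [hf]; norm_num⟩)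
  obtain ⟨y4, h4a, h4b, h4f⟩ := root ((-1) : ℝ) (0 : ℝ) (by norm_num)
    (Or.inl ⟨by rw [hf]; norm_num, by rw [hf]; norm_num⟩)
  obtain ⟨y5, h5a, h5b, h5f⟩ := root (0 : ℝ) (2 : ℝ) (by norm_num)
    (Or.inr ⟨by rw [hf]; norm_num, by rw [hf]; norm_num⟩)
  have hc1y : 2 < c₁ + c₁⁻¹ := by rw [hc₁]; norm_num
  have hy1 : 2 < y1 := lt_trans hc1y h1a
  set s : Multiset ℝ := {y1, y2, y3, y4, y5} with hs
  have h1_2 : y1 ≠ y2 := ne_of_gt (by linarith)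
  have h1_3 : y1 ≠ y3 := ne_of_gt (by linarith)
  have h1_4 : y1 ≠ y4 := ne_of_gt (by linarith)
  have h1_5 : y1 ≠ y5 := ne_of_gt (by linarith)
  have h2_3 : y2 ≠ y3 := ne_of_lt (by linarith)
  have h2_4 : y2 ≠ y4 := ne_of_lt (by linarith)
  have h2_5 : y2 ≠ y5 := ne_of_lt (by linarith)
  have h3_4 : y3 ≠ y4 := ne_of_lt (by linarith)
  have h3_5 : y3 ≠ y5 := ne_of_lt (by linarith)
  have h4_5 : y4 ≠ y5 := ne_of_lt (by linarith)
  have hnodup : s.Nodup := by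
    rw [hs]; simp [Multiset.insert_eq_cons, h1_2, h1_3, h1_4, h1_5, h2_3, h2_4, h2_5, h3_4, h3_5, h4_5]
  have hcard : Multiset.card s = Q.natDegree := by rw [hQdeg, hs]; simp
  have hroot : ∀ y ∈ s, aeval (y : ℂ) Q = 0 := by
    intro y hy
    rw [hfQ]
    rw [hs] at hy
    simp only [Multiset.insert_eq_cons, Multiset.mem_cons, Multiset.mem_singleton] at hy
    rcases hy with rfl | rfl | rfl | rfl | rfl
    · rw [h1f]; simp
    · rw [h2f]; simp
    · rw [h3f]; simp
    · rw [h4f]; simp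
    · rw [h5f]; simp
  have hy₁ : y1 ∈ s := by rw [hs]; simp
  have hbig : 2 < |y1| := by rw [abs_of_pos (by linarith)]; linarith
  have hsmall : ∀ y ∈ s.erase y1, |y| ≤ 2 := by
    intro y hy
    have hy' : y ∈ s ∧ y ≠ y1 := ⟨Multiset.mem_of_mem_erase hy, ((Multiset.Nodup.mem_erase_iff hnodup).mp hy).1⟩
    rw [hs] at hy'
    simp only [Multiset.insert_eq_cons, Multiset.mem_cons, Multiset.mem_singleton] at hy'
    obtain ⟨hy'', hne⟩ := hy'
    rcases hy'' with rfl | rfl | rfl | rfl | rfl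
    · exact absurd rfl hne
    · rw [abs_le]; constructor <;> linarith
    · rw [abs_le]; constructor <;> linarith
    · rw [abs_le]; constructor <;> linarith
    · rw [abs_le]; constructor <;> linarith
  obtain ⟨-, hM1, hMM⟩ := salem_traceLift_certificate hQmonic s hnodup hcard hroot hy₁ hbig hsmall
  rw [traceLift_c10_03] at hM1 hMM
  rw [abs_of_pos (by linarith)] at hMM
  have hMpos : 0 < intMahlerMeasure (ofCoeffs c10_03) := by linarith
  constructor
  · have h : c₁ + c₁⁻¹ < intMahlerMeasure (ofCoeffs c10_03) + (intMahlerMeasure (ofCoeffs c10_03))⁻¹ := by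
      rw [hMM]; linarith
    exact lt_of_add_inv_lt_add_inv hM1.le (by rw [hc₁]; norm_num) h
  · have h : intMahlerMeasure (ofCoeffs c10_03) + (intMahlerMeasure (ofCoeffs c10_03))⁻¹ < c₂ + c₂⁻¹ := by
      rw [hMM]; linarith
    exact lt_of_add_inv_lt_add_inv (by rw [hc₂]; norm_num) hMpos h

end Summit.Ventures.DiscreteObjects.Mahler
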